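/-
Copyright: the b2b-balaban T⁴-continuum CRUX team, row NE7b OWNER lineage `t4-ne7b-p1` (gen 131). Project licence.
-/
import Summits.QuantumFields.BalabanUV.T4Continuum.Spine.NE7b.SupNextHessianLocality
import Summits.QuantumFields.BalabanUV.T4Continuum.Spine.NE7b.SupNextPotentialCubicRoad

/-!
# EVERY ENTRY OF THE NEXT HESSIAN IS `O(1)`, UNIFORMLY IN THE VOLUME: on the road's small-field step over the cells of `S` (finite-range
# Gaussian, sup-small stable `C²` remainders with `|w′| ≤ κ₁|u|`, `|w″| ≤ κ₂`, KP smallness at the radius `Ψ`), for ALL sites `y ∈ cell p₀`,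
# `z ∈ cell p₁`, `p₀, p₁ ∈ S` (near, far or equal):
#   `|D²(−log Z_·(S))(ψ₀)(e_y, e_z)| ≤ κ₂ + κ₁²δ₀⁻¹M′ + (κ₁(1+δ₀⁻¹)M′)²`,  `M′ = exp(2(Δ+1)2e·ε̃_ΨA_τ^v)`
# — the covariance formula (320) at `(e_y, e_z)` (the `w″` term picks the site `z`, the gradient sums pick `y` and `z`) under the single-site
# tilted moment letters of (329); the NEAR-DIAGONAL companion of (333)'s exponential decay, the two together feeding the weighted row sums of
# (340) (row NE7b, node U5c; (319)∕(320)∕(329)∕(333)∕(337b)∕(339) BY NAME; [folklore])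

Cell `pub-balaban`, sub-cell `t4`, spine estimate NE7b (`T4WeightBudget.RelWeightBound`; the cell's OWN estimate — NOT PRINTED in
[Bałaban 1983–89], NOT PROVED).  Crux-route work under `Spine/NE7b/` by the row OWNER (`t4-ne7b-p1` gen 131, file (341)) under FREEZE
(0)'s crux-prover clause, on § [NE7bP1-G130-HANDOFF] NEXT (3)(c) (the near entries of the exponentially weighted row sum); NOTHING of
Bałaban's is named as a Lean object, valued or asserted; no `T4Continuum/Support` leaf typed; no `def`, no notation; zero `sorry`.  Imports
(BY NAME): the OWNER's (333) `…SupNextHessianLocality` (`cov_rearrange`; through it (319) `hasFDerivAt_fderiv_neg_log_step`, (320)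
`hessian_neg_log_step_apply`, (314) `single_cellSum`), (339) `…SupNextPotentialCubicRoad` (`integrable_mul_of_dominated`, `abs_le_mul_exp_sq`;
through it (337b) `abs_integral_div_le_of_dominated`, (329) `tilted_mean_le_of_supSmall`, (323) `sq_le_inv_mul_exp_sq`,
`integrable_exp_neg_mul_expSq`, (297) `integrable_exp_neg`, `cellSum_eq_sum_biUnion`).

WHAT IS PROVED ([folklore]):
* §1 `abs_single_le_one` (`|(e_y)_x| ≤ 1`), the pointwise letters `pointwise_T`, `pointwise_A`, `cell_letter_phi` (cell form of (339) `letter_phi` at `ψ₀`: `e^{−V}φ(u_q)` integrable and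
  `∫e^{−V}φ(u_q) ≤ Z·(a·M′)` for measurable `0 ≤ φ ≤ ae^{δ₀u²}`, `q` in a cell of `S`);
* §2 THE END **`abs_hessian_entry_le`**: `|D²(−log Z_·(S))(ψ₀)(e_y)(e_z)| ≤ κ₂ + κ₁²δ₀⁻¹M′ + (κ₁(1+δ₀⁻¹)M′)²` for all `y, z` in the cells
  of `S` (`|w″_z(e_y)_z − w′_yw′_z| ≤ κ₂ + κ₁²(u_y² + u_z²)∕2` integrated against `e^{−V}`, and `(|∫e^{−V}w′_y|∕Z)(|∫e^{−V}w′_z|∕Z) ≤ (κ₁L₁)²`);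
  §3 toy.

HONEST (what this is NOT).  A uniform O(1) entry bound (no decay — that is (333) for cells `≥ 2` apart in a potential); `(319)`'s domination
slack is taken as `δ = δ₀(1+τ)∕2` from `2(κ₀+δ₀) ≤ κ`; scalar skeleton ((A3), NC-NE7b-α UNRULED); nothing of Bałaban's asserted.  BY-NAME
EFFECT ON THE WALL: NONE.  NE7b NOT PRINTED ∕ NOT PROVED; spine PROVED 0∕9; rung (B)+1 — the programme's measures remain FINITE-torus
statements; NOT the mass gap, NOT Clay.  HONEST DEPENDENCY: continuum YM on T⁴ ⇐ BetaPertH ∧ nine spine estimates (0∕9 proved); BetaPertH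
⇐ (D1) ∧ (D4) ∧ CAP+tail; G-an2-4 gates asym, D1 and NE2∕3∕4.
-/

set_option autoImplicit false

noncomputable section

namespace Summit.QuantumFields.BalabanUV.T4Continuum.NE7b.SupNextHessianEntryBound

open MeasureTheory ProbabilityTheory Finset Real
open scoped BigOperators
open Literature.Analysis.Matrix (HasFiniteRange)
open SupNextHessianLocality (cov_rearrange)
open SupEffectiveActionCovariance (hessian_neg_log_step_apply)
open SupEffectiveActionHessian (hasFDerivAt_fderiv_neg_log_step)
open SupEffectiveActionGradientSmall (single_cellSum)
open SupEffectiveActionDerivative (mul_opBound_le_of_le)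
open SupSmallFieldGasReal (cellSum_eq_sum_biUnion)
open SupFluctuationAPriori (integrable_exp_neg)
open SupRegulatedTiltedMoments (tilted_mean_le_of_supSmall)
open SupTiltedSingleSiteMoments (sq_le_inv_mul_exp_sq integrable_exp_neg_mul_expSq)
open SupNextPotentialThirdLetter (abs_integral_div_le_of_dominated)
open SupNextPotentialCubicRoad (integrable_mul_of_dominated abs_le_mul_exp_sq)

set_option maxSynthPendingDepth 2

variable {ι : Type} [Fintype ι] [DecidableEq ι] {V : Type*} [DecidableEq V]

/-! ## §1. Bookkeeping and the cell-form moment letter -/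

omit [Fintype ι] in
/-- `|(e_y)_x| ≤ 1`. [folklore] -/
theorem abs_single_le_one (y x : ι) : |(EuclideanSpace.single y (1 : ℝ)) x| ≤ 1 := by
  simp_rw [EuclideanSpace.single, PiLp.single_apply]
  split_ifs <;> simp

omit [Fintype ι] [DecidableEq ι] in
/-- The pointwise letter of the covariance integrand: `|s| ≤ 1`, `|w₂| ≤ κ₂`, `|w_y| ≤ κ₁|a|`, `|w_z| ≤ κ₁|b|`, `E > 0` ⟹
`|E·(w₂s − w_yw_z)| ≤ κ₂E + ½κ₁²(Ea²) + ½κ₁²(Eb²)`. [folklore] -/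
theorem pointwise_T {E a b s wy wz w₂ κ₁ κ₂ : ℝ} (hE : 0 < E) (hs : |s| ≤ 1) (hw₂ : |w₂| ≤ κ₂) (hκ₂ : 0 ≤ κ₂)
    (hy : |wy| ≤ κ₁ * |a|) (hz : |wz| ≤ κ₁ * |b|) (hκ₁ : 0 ≤ κ₁) :
    |E * (w₂ * s - wy * wz)| ≤ κ₂ * E + κ₁ ^ 2 / 2 * (E * a ^ 2) + κ₁ ^ 2 / 2 * (E * b ^ 2) := by
  rw [abs_mul, abs_of_pos hE]
  have h1 : |w₂ * s| ≤ κ₂ := by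
    rw [abs_mul]
    calc |w₂| * |s| ≤ κ₂ * 1 := mul_le_mul hw₂ hs (abs_nonneg _) hκ₂
      _ = κ₂ := mul_one κ₂
  have h2 : |wy * wz| ≤ κ₁ ^ 2 / 2 * a ^ 2 + κ₁ ^ 2 / 2 * b ^ 2 := by
    rw [abs_mul]
    have hp : |wy| * |wz| ≤ (κ₁ * |a|) * (κ₁ * |b|) := mul_le_mul hy hz (abs_nonneg _) (by positivity)
    nlinarith [sq_nonneg (|a| - |b|), sq_abs a, sq_abs b, sq_nonneg κ₁]
  have h3 := abs_sub (w₂ * s) (wy * wz)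
  have h4 : E * |w₂ * s - wy * wz| ≤ E * (κ₂ + (κ₁ ^ 2 / 2 * a ^ 2 + κ₁ ^ 2 / 2 * b ^ 2)) :=
    mul_le_mul_of_nonneg_left (by linarith) hE.le
  refine h4.trans (le_of_eq ?_)
  ring

omit [Fintype ι] [DecidableEq ι] in
/-- The pointwise letter of the mean integrand: `|w_y| ≤ κ₁|a|`, `E > 0` ⟹ `|E·w_y| ≤ κ₁(E|a|)`. [folklore] -/
theorem pointwise_A {E a wy κ₁ : ℝ} (hE : 0 < E) (hy : |wy| ≤ κ₁ * |a|) : |E * wy| ≤ κ₁ * (E * |a|) := by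
  rw [abs_mul, abs_of_pos hE]
  calc E * |wy| ≤ E * (κ₁ * |a|) := mul_le_mul_of_nonneg_left hy hE.le
    _ = κ₁ * (E * |a|) := by ring

section Main

variable {Γ : Matrix ι ι ℝ} {γop γ : ℝ} {dι : ι → ι → ℕ} {ρ : ℕ} {cell : V → Finset ι} {v : ℕ} {R : V → V → Prop}
  [DecidableRel R] [Std.Symm R] {nbr : V → Finset V} {Δ : ℕ} {w w' w'' : ι → ℝ → ℝ} {κ₀ κ₁ κ₂ δ₀ b r κ τ θ Ψ : ℝ}

/-- **The single-site letter in cell form**: road data as in (329) (`0 < δ₀`), `ψ₀` small on the cells of `S`, KP smallness, `q ∈ cell p_q`,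
`p_q ∈ S`, measurable `0 ≤ φ ≤ a·e^{δ₀u²}` ⟹ `e^{−V}φ(u_q)` is integrable and `∫e^{−V}φ(u_q) ≤ Z·(a·M′)`. [folklore] -/
theorem cell_letter_phi (hΓ : Γ.PosSemidef) (hΓop : (γop • (1 : Matrix ι ι ℝ) - Γ).PosSemidef) (hdiag : ∀ i, Γ i i ≤ γ)
    (hγ : 0 ≤ γ) (hfr : HasFiniteRange dι ρ Γ) (hdisj : ∀ p q, p ≠ q → Disjoint (cell p) (cell q)) (hv : ∀ p, (cell p).card ≤ v)
    (hR : ∀ (p p' : V) (x y : ι), x ∈ cell p → y ∈ cell p' → dι x y ≤ ρ → p = p' ∨ R p p')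
    (hΔ : ∀ x, (nbr x).card ≤ Δ) (hnbr : ∀ x y, R x y → y ∈ nbr x) (hw : ∀ x, Measurable (w x))
    (hκ₀ : 0 ≤ κ₀) (hδ₀ : 0 < δ₀) (hb : 0 ≤ b) (hr : 0 ≤ r) (hstab : ∀ x, ∀ t : ℝ, -(κ₀ * t ^ 2) ≤ w x t)
    (hsup : ∀ x, ∀ t : ℝ, |t| ≤ r → |w x t| ≤ b) (hκ : 2 * (κ₀ + δ₀) ≤ κ)
    (hτ : 0 < τ) (hθ0 : 0 < θ) (hθ1 : θ < 1) (hκθ : κ * (1 + τ) * γop ≤ θ) (S : Finset V) (ψ₀ : EuclideanSpace ℝ ι)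
    (hψ : ∀ p ∈ S, ∑ x ∈ cell p, ψ₀ x ^ 2 ≤ Ψ ^ 2)
    (hsmall : Real.exp 1 * (((max (exp (v * (b + δ₀ * r ^ 2)) - 1) (2 * exp (-((κ / 2 - (κ₀ + δ₀)) * r ^ 2)))) * exp (κ * (1 + τ⁻¹) * Ψ ^ 2 / 2)) * ((1 - θ) ^ (-(κ * (1 + τ) * γ / (2 * θ)))) ^ v) * ((Δ : ℝ) + 1) ^ 2 ≤ 1 / 2)
    {pq : V} (hpq : pq ∈ S) {q : ι} (hq : q ∈ cell pq)
    {φ : ℝ → ℝ} {a : ℝ} (hφm : Measurable φ) (hφ0 : ∀ u, 0 ≤ φ u) (hφ : ∀ u, φ u ≤ a * exp (δ₀ * u ^ 2)) :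
    Integrable (fun ω : EuclideanSpace ℝ ι => exp (-(∑ p ∈ S, ∑ x ∈ cell p, w x (ω x + ψ₀ x))) * φ (ω q + ψ₀ q)) (multivariateGaussian 0 Γ) ∧
      ∫ ω : EuclideanSpace ℝ ι, exp (-(∑ p ∈ S, ∑ x ∈ cell p, w x (ω x + ψ₀ x))) * φ (ω q + ψ₀ q) ∂(multivariateGaussian 0 Γ) ≤
        (∫ ω : EuclideanSpace ℝ ι, exp (-(∑ p ∈ S, ∑ x ∈ cell p, w x (ω x + ψ₀ x))) ∂(multivariateGaussian 0 Γ)) *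
          (a * exp (2 * ((1 : ℝ) * ((Δ : ℝ) + 1) * (2 * (Real.exp 1 * (((max (exp (v * (b + δ₀ * r ^ 2)) - 1) (2 * exp (-((κ / 2 - (κ₀ + δ₀)) * r ^ 2)))) * exp (κ * (1 + τ⁻¹) * Ψ ^ 2 / 2)) *
        ((1 - θ) ^ (-(κ * (1 + τ) * γ / (2 * θ)))) ^ v)))))) := by
  have hκθ₀ : 2 * κ₀ * (1 + τ) * γop ≤ θ := by
    have := mul_opBound_le_of_le (a := 2 * κ₀ * (1 + τ)) (b := κ * (1 + τ)) (by positivity)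
      (mul_le_mul_of_nonneg_right (by linarith) (by linarith)) hθ0.le (by simpa [mul_assoc] using hκθ)
    simpa [mul_assoc] using this
  have hκθ₁ : 2 * (κ₀ + δ₀) * (1 + τ) * γop ≤ θ := by
    have := mul_opBound_le_of_le (a := 2 * (κ₀ + δ₀) * (1 + τ)) (b := κ * (1 + τ)) (by positivity)
      (mul_le_mul_of_nonneg_right hκ (by linarith)) hθ0.le (by simpa [mul_assoc] using hκθ)
    simpa [mul_assoc] using this
  have hZ : 0 < (∫ ω : EuclideanSpace ℝ ι, exp (-(∑ p ∈ S, ∑ x ∈ cell p, w x (ω x + ψ₀ x))) ∂(multivariateGaussian 0 Γ)) := by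
    have hI := integrable_exp_neg hΓ hΓop (S.biUnion cell) w hw hκ₀ hτ hθ1 hκθ₀ hstab (fun x => ψ₀ x)
    have hI' : Integrable (fun ω : EuclideanSpace ℝ ι => exp (-(∑ p ∈ S, ∑ x ∈ cell p, w x (ω x + ψ₀ x)))) (multivariateGaussian 0 Γ) :=
      hI.congr (ae_of_all _ fun ω => by simp only; rw [← cellSum_eq_sum_biUnion cell hdisj S])
    exact integral_exp_pos hI'
  have key := tilted_mean_le_of_supSmall hΓ hΓop hdiag hγ hfr hdisj hv hR hΔ hnbr hw hκ₀ hδ₀.le hb hr hstab hsup hκ hτ hθ0 hθ1 hκθ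
    S ψ₀ hψ hpq hq hsmall hφ0 hφ
  rw [inv_mul_le_iff₀ hZ] at key
  have hD := integrable_exp_neg_mul_expSq hΓ hΓop hdisj hw hκ₀ hδ₀.le hstab hτ hθ1 hκθ₁ S ψ₀ hpq hq
  have hsite : Measurable fun ω : EuclideanSpace ℝ ι => ω q + ψ₀ q := (by fun_prop : Measurable fun ω : EuclideanSpace ℝ ι => ω q).add_const _
  have hEm : Measurable fun ω : EuclideanSpace ℝ ι => exp (-(∑ p ∈ S, ∑ x ∈ cell p, w x (ω x + ψ₀ x))) :=
    measurable_exp.comp (Finset.measurable_sum _ fun p _ => Finset.measurable_sum _ fun x _ =>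
      (hw x).comp ((by fun_prop : Measurable fun ω : EuclideanSpace ℝ ι => ω x).add_const _)).neg
  exact ⟨integrable_mul_of_dominated hD hEm (hφm.comp hsite) (fun ω => (exp_pos _).le) (fun ω => hφ0 _) (fun ω => hφ _), key⟩

/-! ## §2. THE END: every entry of the next Hessian is `O(1)` -/

/-- **EVERY ENTRY OF THE NEXT HESSIAN IS `O(1)`.**  Road data as in `cell_letter_phi`, `C²` remainders (`HasDerivAt` letters for `w, w′`,
measurable `w′, w″`, `|w′| ≤ κ₁|u|`, `|w″| ≤ κ₂`, `κ₁ ≥ 0`), `y ∈ cell p₀`, `z ∈ cell p₁`, `p₀, p₁ ∈ S` (ANY two sites of the cells of `S`) ⟹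
`|D²(−log Z_·(S))(ψ₀)(e_y)(e_z)| ≤ κ₂ + κ₁²δ₀⁻¹M′ + (κ₁(1+δ₀⁻¹)M′)²`. [folklore] -/
theorem abs_hessian_entry_le (hΓ : Γ.PosSemidef) (hΓop : (γop • (1 : Matrix ι ι ℝ) - Γ).PosSemidef) (hdiag : ∀ i, Γ i i ≤ γ)
    (hγ : 0 ≤ γ) (hfr : HasFiniteRange dι ρ Γ) (hdisj : ∀ p q, p ≠ q → Disjoint (cell p) (cell q)) (hv : ∀ p, (cell p).card ≤ v)
    (hR : ∀ (p p' : V) (x y : ι), x ∈ cell p → y ∈ cell p' → dι x y ≤ ρ → p = p' ∨ R p p')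
    (hΔ : ∀ x, (nbr x).card ≤ Δ) (hnbr : ∀ x y, R x y → y ∈ nbr x) (hw' : ∀ x t, HasDerivAt (w x) (w' x t) t)
    (hw'' : ∀ x t, HasDerivAt (w' x) (w'' x t) t) (hw'm : ∀ x, Measurable (w' x)) (hw''m : ∀ x, Measurable (w'' x))
    (hκ₀ : 0 ≤ κ₀) (hκ₁ : 0 ≤ κ₁) (hδ₀ : 0 < δ₀) (hb : 0 ≤ b) (hr : 0 ≤ r) (hstab : ∀ x, ∀ t : ℝ, -(κ₀ * t ^ 2) ≤ w x t)
    (hsup : ∀ x, ∀ t : ℝ, |t| ≤ r → |w x t| ≤ b) (hw'b : ∀ x t, |w' x t| ≤ κ₁ * |t|) (hw''b : ∀ x t, |w'' x t| ≤ κ₂)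
    (hκ : 2 * (κ₀ + δ₀) ≤ κ) (hτ : 0 < τ) (hθ0 : 0 < θ) (hθ1 : θ < 1) (hκθ : κ * (1 + τ) * γop ≤ θ) (S : Finset V)
    (ψ₀ : EuclideanSpace ℝ ι) (hψ : ∀ p ∈ S, ∑ x ∈ cell p, ψ₀ x ^ 2 ≤ Ψ ^ 2) {p₀ p₁ : V} (hp₀ : p₀ ∈ S) (hp₁ : p₁ ∈ S) {y z : ι}
    (hy : y ∈ cell p₀) (hz : z ∈ cell p₁)
    (hsmall : Real.exp 1 * (((max (exp (v * (b + δ₀ * r ^ 2)) - 1) (2 * exp (-((κ / 2 - (κ₀ + δ₀)) * r ^ 2)))) * exp (κ * (1 + τ⁻¹) * Ψ ^ 2 / 2)) * ((1 - θ) ^ (-(κ * (1 + τ) * γ / (2 * θ)))) ^ v) * ((Δ : ℝ) + 1) ^ 2 ≤ 1 / 2) :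
    |(fderiv ℝ (fun ψ : EuclideanSpace ℝ ι => fderiv ℝ (fun φ : EuclideanSpace ℝ ι =>
        -log (∫ ω : EuclideanSpace ℝ ι, exp (-(∑ p ∈ S, ∑ x ∈ cell p, w x (ω x + φ x))) ∂(multivariateGaussian 0 Γ))) ψ) ψ₀
        (EuclideanSpace.single y (1 : ℝ))) (EuclideanSpace.single z (1 : ℝ))| ≤
      κ₂ + κ₁ ^ 2 * (δ₀⁻¹ * exp (2 * ((1 : ℝ) * ((Δ : ℝ) + 1) * (2 * (Real.exp 1 * (((max (exp (v * (b + δ₀ * r ^ 2)) - 1) (2 * exp (-((κ / 2 - (κ₀ + δ₀)) * r ^ 2)))) * exp (κ * (1 + τ⁻¹) * Ψ ^ 2 / 2)) * ((1 - θ) ^ (-(κ * (1 + τ) * γ / (2 * θ)))) ^ v)))))) +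
        (κ₁ * ((1 + δ₀⁻¹) * exp (2 * ((1 : ℝ) * ((Δ : ℝ) + 1) * (2 * (Real.exp 1 * (((max (exp (v * (b + δ₀ * r ^ 2)) - 1) (2 * exp (-((κ / 2 - (κ₀ + δ₀)) * r ^ 2)))) * exp (κ * (1 + τ⁻¹) * Ψ ^ 2 / 2)) * ((1 - θ) ^ (-(κ * (1 + τ) * γ / (2 * θ)))) ^ v))))))) ^ 2 := by
  -- (319)'s letters: `δ := δ₀(1+τ)∕2`
  have hδ : 0 < δ₀ * (1 + τ) / 2 := by positivity
  have hκθ' : (2 * κ₀ * (1 + τ) + 4 * (δ₀ * (1 + τ) / 2)) * γop ≤ θ := by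
    have e : (2 * κ₀ * (1 + τ) + 4 * (δ₀ * (1 + τ) / 2)) = 2 * (κ₀ + δ₀) * (1 + τ) := by ring
    rw [e]
    exact mul_opBound_le_of_le (a := 2 * (κ₀ + δ₀) * (1 + τ)) (b := κ * (1 + τ)) (by positivity)
      (mul_le_mul_of_nonneg_right hκ (by linarith)) hθ0.le hκθ
  have hw : ∀ x, Measurable (w x) := fun x => (continuous_iff_continuousAt.2 fun t => (hw' x t).continuousAt).measurable
  have hκ₂ : 0 ≤ κ₂ := (abs_nonneg _).trans (hw''b y 0)
  -- the Hessian is (319)'s form; (320) evaluates it at `e_y, e_z`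
  rw [(hasFDerivAt_fderiv_neg_log_step hΓ hΓop hdisj hw' hw'' hw'm hw''m hκ₀ hκ₁ hτ hδ hθ0 hθ1 hκθ' hstab hw'b hw''b S ψ₀).fderiv,
    hessian_neg_log_step_apply hΓ hΓop hdisj hw' hw'm hw''m hκ₀ hκ₁ hτ hδ hθ1 hκθ' hstab hw'b hw''b S ψ₀ (EuclideanSpace.single y (1 : ℝ)) (EuclideanSpace.single z (1 : ℝ))]
  -- the `w″` sum picks the site `z`, the gradient sums pick `y` and `z`
  have eAB : (∫ ω : EuclideanSpace ℝ ι, exp (-(∑ p ∈ S, ∑ x ∈ cell p, w x (ω x + ψ₀ x))) *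
            (∑ p ∈ S, ∑ x ∈ cell p, w'' x (ω x + ψ₀ x) * (EuclideanSpace.single y (1 : ℝ)) x * (EuclideanSpace.single z (1 : ℝ)) x -
              (∑ p ∈ S, ∑ x ∈ cell p, w' x (ω x + ψ₀ x) * (EuclideanSpace.single y (1 : ℝ)) x) * (∑ p ∈ S, ∑ x ∈ cell p, w' x (ω x + ψ₀ x) * (EuclideanSpace.single z (1 : ℝ)) x)) ∂(multivariateGaussian 0 Γ)) =
      (∫ ω : EuclideanSpace ℝ ι, exp (-(∑ p ∈ S, ∑ x ∈ cell p, w x (ω x + ψ₀ x))) * (w'' z (ω z + ψ₀ z) * (EuclideanSpace.single y (1 : ℝ)) z - w' y (ω y + ψ₀ y) * w' z (ω z + ψ₀ z)) ∂(multivariateGaussian 0 Γ)) :=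
    integral_congr_ae (ae_of_all _ fun ω => by
      dsimp only
      have hW : ∑ p ∈ S, ∑ x ∈ cell p, w'' x (ω x + ψ₀ x) * (EuclideanSpace.single y (1 : ℝ)) x * (EuclideanSpace.single z (1 : ℝ)) x = w'' z (ω z + ψ₀ z) * (EuclideanSpace.single y (1 : ℝ)) z :=
        single_cellSum (w' := fun x u => w'' x u * (EuclideanSpace.single y (1 : ℝ)) x) hdisj S hp₁ hz ω ψ₀
      rw [hW, single_cellSum hdisj S hp₀ hy ω ψ₀, single_cellSum hdisj S hp₁ hz ω ψ₀])
  have eA : (∫ ω : EuclideanSpace ℝ ι, exp (-(∑ p ∈ S, ∑ x ∈ cell p, w x (ω x + ψ₀ x))) *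
              (∑ p ∈ S, ∑ x ∈ cell p, w' x (ω x + ψ₀ x) * (EuclideanSpace.single y (1 : ℝ)) x) ∂(multivariateGaussian 0 Γ)) =
      (∫ ω : EuclideanSpace ℝ ι, exp (-(∑ p ∈ S, ∑ x ∈ cell p, w x (ω x + ψ₀ x))) * w' y (ω y + ψ₀ y) ∂(multivariateGaussian 0 Γ)) :=
    integral_congr_ae (ae_of_all _ fun ω => by
      dsimp only
      rw [single_cellSum hdisj S hp₀ hy ω ψ₀])
  have eB : (∫ ω : EuclideanSpace ℝ ι, exp (-(∑ p ∈ S, ∑ x ∈ cell p, w x (ω x + ψ₀ x))) *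
              (∑ p ∈ S, ∑ x ∈ cell p, w' x (ω x + ψ₀ x) * (EuclideanSpace.single z (1 : ℝ)) x) ∂(multivariateGaussian 0 Γ)) =
      (∫ ω : EuclideanSpace ℝ ι, exp (-(∑ p ∈ S, ∑ x ∈ cell p, w x (ω x + ψ₀ x))) * w' z (ω z + ψ₀ z) ∂(multivariateGaussian 0 Γ)) :=
    integral_congr_ae (ae_of_all _ fun ω => by
      dsimp only
      rw [single_cellSum hdisj S hp₁ hz ω ψ₀])
  rw [eAB, eA, eB]
  -- the letters: `Z > 0`, `L₁ = (1+δ₀⁻¹)M′`, `L₂ = δ₀⁻¹M′`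
  have l1y := cell_letter_phi hΓ hΓop hdiag hγ hfr hdisj hv hR hΔ hnbr hw hκ₀ hδ₀ hb hr hstab hsup hκ hτ hθ0 hθ1 hκθ S ψ₀ hψ hsmall hp₀ hy
    (φ := fun u => |u|) (a := 1 + δ₀⁻¹) continuous_abs.measurable (fun u => abs_nonneg u) (fun u => abs_le_mul_exp_sq hδ₀ u)
  have l1z := cell_letter_phi hΓ hΓop hdiag hγ hfr hdisj hv hR hΔ hnbr hw hκ₀ hδ₀ hb hr hstab hsup hκ hτ hθ0 hθ1 hκθ S ψ₀ hψ hsmall hp₁ hz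
    (φ := fun u => |u|) (a := 1 + δ₀⁻¹) continuous_abs.measurable (fun u => abs_nonneg u) (fun u => abs_le_mul_exp_sq hδ₀ u)
  have l2y := cell_letter_phi hΓ hΓop hdiag hγ hfr hdisj hv hR hΔ hnbr hw hκ₀ hδ₀ hb hr hstab hsup hκ hτ hθ0 hθ1 hκθ S ψ₀ hψ hsmall hp₀ hy
    (φ := fun u => u ^ 2) (a := δ₀⁻¹) (measurable_id.pow_const 2) (fun u => sq_nonneg u) (fun u => sq_le_inv_mul_exp_sq hδ₀ u)
  have l2z := cell_letter_phi hΓ hΓop hdiag hγ hfr hdisj hv hR hΔ hnbr hw hκ₀ hδ₀ hb hr hstab hsup hκ hτ hθ0 hθ1 hκθ S ψ₀ hψ hsmall hp₁ hz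
    (φ := fun u => u ^ 2) (a := δ₀⁻¹) (measurable_id.pow_const 2) (fun u => sq_nonneg u) (fun u => sq_le_inv_mul_exp_sq hδ₀ u)
  have hint : Integrable (fun ω : EuclideanSpace ℝ ι => exp (-(∑ p ∈ S, ∑ x ∈ cell p, w x (ω x + ψ₀ x)))) (multivariateGaussian 0 Γ) := by
    have hκθ₀ : 2 * κ₀ * (1 + τ) * γop ≤ θ :=
      mul_opBound_le_of_le (a := 2 * κ₀ * (1 + τ)) (b := 2 * κ₀ * (1 + τ) + 4 * (δ₀ * (1 + τ) / 2)) (by positivity)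
        (by linarith [hδ.le]) hθ0.le hκθ'
    have hI := integrable_exp_neg hΓ hΓop (S.biUnion cell) w hw hκ₀ hτ hθ1 hκθ₀ hstab (fun x => ψ₀ x)
    exact hI.congr (ae_of_all _ fun ω => by simp only; rw [← cellSum_eq_sum_biUnion cell hdisj S])
  have hZ : 0 < (∫ ω : EuclideanSpace ℝ ι, exp (-(∑ p ∈ S, ∑ x ∈ cell p, w x (ω x + ψ₀ x))) ∂(multivariateGaussian 0 Γ)) := integral_exp_pos hint
  -- |T|∕Z ≤ κ₂ + κ₁²L₂
  have hG : Integrable (fun ω : EuclideanSpace ℝ ι => κ₂ * exp (-(∑ p ∈ S, ∑ x ∈ cell p, w x (ω x + ψ₀ x))) +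
      κ₁ ^ 2 / 2 * (exp (-(∑ p ∈ S, ∑ x ∈ cell p, w x (ω x + ψ₀ x))) * (ω y + ψ₀ y) ^ 2) + κ₁ ^ 2 / 2 * (exp (-(∑ p ∈ S, ∑ x ∈ cell p, w x (ω x + ψ₀ x))) * (ω z + ψ₀ z) ^ 2)) (multivariateGaussian 0 Γ) :=
    ((hint.const_mul κ₂).add (l2y.1.const_mul _)).add (l2z.1.const_mul _)
  have hT : |(∫ ω : EuclideanSpace ℝ ι, exp (-(∑ p ∈ S, ∑ x ∈ cell p, w x (ω x + ψ₀ x))) * (w'' z (ω z + ψ₀ z) * (EuclideanSpace.single y (1 : ℝ)) z - w' y (ω y + ψ₀ y) * w' z (ω z + ψ₀ z)) ∂(multivariateGaussian 0 Γ))| /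
      (∫ ω : EuclideanSpace ℝ ι, exp (-(∑ p ∈ S, ∑ x ∈ cell p, w x (ω x + ψ₀ x))) ∂(multivariateGaussian 0 Γ)) ≤ κ₂ + κ₁ ^ 2 * (δ₀⁻¹ * exp (2 * ((1 : ℝ) * ((Δ : ℝ) + 1) * (2 * (Real.exp 1 * (((max (exp (v * (b + δ₀ * r ^ 2)) - 1) (2 * exp (-((κ / 2 - (κ₀ + δ₀)) * r ^ 2)))) * exp (κ * (1 + τ⁻¹) * Ψ ^ 2 / 2)) * ((1 - θ) ^ (-(κ * (1 + τ) * γ / (2 * θ)))) ^ v)))))) := by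
    refine abs_integral_div_le_of_dominated (μ := (multivariateGaussian 0 Γ)) hZ hG (fun ω => ?_) ?_
    · exact pointwise_T (exp_pos _) (abs_single_le_one y z) (hw''b z _) hκ₂ (hw'b y _) (hw'b z _) hκ₁
    · have hGy : Integrable (fun ω : EuclideanSpace ℝ ι => κ₂ * exp (-(∑ p ∈ S, ∑ x ∈ cell p, w x (ω x + ψ₀ x))) +
          κ₁ ^ 2 / 2 * (exp (-(∑ p ∈ S, ∑ x ∈ cell p, w x (ω x + ψ₀ x))) * (ω y + ψ₀ y) ^ 2)) (multivariateGaussian 0 Γ) := (hint.const_mul κ₂).add (l2y.1.const_mul _)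
      have e1 := integral_add hGy (l2z.1.const_mul (κ₁ ^ 2 / 2))
      have e2 := integral_add (hint.const_mul κ₂) (l2y.1.const_mul (κ₁ ^ 2 / 2))
      rw [e1, e2, integral_const_mul, integral_const_mul, integral_const_mul]
      have iy := mul_le_mul_of_nonneg_left l2y.2 (by positivity : (0 : ℝ) ≤ κ₁ ^ 2 / 2)
      have iz := mul_le_mul_of_nonneg_left l2z.2 (by positivity : (0 : ℝ) ≤ κ₁ ^ 2 / 2)
      have e3 : (∫ ω : EuclideanSpace ℝ ι, exp (-(∑ p ∈ S, ∑ x ∈ cell p, w x (ω x + ψ₀ x))) ∂(multivariateGaussian 0 Γ)) *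
            (κ₂ + κ₁ ^ 2 * (δ₀⁻¹ * exp (2 * ((1 : ℝ) * ((Δ : ℝ) + 1) * (2 * (Real.exp 1 * (((max (exp (v * (b + δ₀ * r ^ 2)) - 1) (2 * exp (-((κ / 2 - (κ₀ + δ₀)) * r ^ 2)))) * exp (κ * (1 + τ⁻¹) * Ψ ^ 2 / 2)) * ((1 - θ) ^ (-(κ * (1 + τ) * γ / (2 * θ)))) ^ v))))))) =
          κ₂ * (∫ ω : EuclideanSpace ℝ ι, exp (-(∑ p ∈ S, ∑ x ∈ cell p, w x (ω x + ψ₀ x))) ∂(multivariateGaussian 0 Γ)) +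
            κ₁ ^ 2 / 2 * ((∫ ω : EuclideanSpace ℝ ι, exp (-(∑ p ∈ S, ∑ x ∈ cell p, w x (ω x + ψ₀ x))) ∂(multivariateGaussian 0 Γ)) *
              (δ₀⁻¹ * exp (2 * ((1 : ℝ) * ((Δ : ℝ) + 1) * (2 * (Real.exp 1 * (((max (exp (v * (b + δ₀ * r ^ 2)) - 1) (2 * exp (-((κ / 2 - (κ₀ + δ₀)) * r ^ 2)))) * exp (κ * (1 + τ⁻¹) * Ψ ^ 2 / 2)) * ((1 - θ) ^ (-(κ * (1 + τ) * γ / (2 * θ)))) ^ v))))))) +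
            κ₁ ^ 2 / 2 * ((∫ ω : EuclideanSpace ℝ ι, exp (-(∑ p ∈ S, ∑ x ∈ cell p, w x (ω x + ψ₀ x))) ∂(multivariateGaussian 0 Γ)) *
              (δ₀⁻¹ * exp (2 * ((1 : ℝ) * ((Δ : ℝ) + 1) * (2 * (Real.exp 1 * (((max (exp (v * (b + δ₀ * r ^ 2)) - 1) (2 * exp (-((κ / 2 - (κ₀ + δ₀)) * r ^ 2)))) * exp (κ * (1 + τ⁻¹) * Ψ ^ 2 / 2)) * ((1 - θ) ^ (-(κ * (1 + τ) * γ / (2 * θ)))) ^ v))))))) := by ring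
      rw [e3]
      linarith [iy, iz]
  -- |I_A|∕Z, |I_B|∕Z ≤ κ₁L₁
  have hIA : |(∫ ω : EuclideanSpace ℝ ι, exp (-(∑ p ∈ S, ∑ x ∈ cell p, w x (ω x + ψ₀ x))) * w' y (ω y + ψ₀ y) ∂(multivariateGaussian 0 Γ))| /
      (∫ ω : EuclideanSpace ℝ ι, exp (-(∑ p ∈ S, ∑ x ∈ cell p, w x (ω x + ψ₀ x))) ∂(multivariateGaussian 0 Γ)) ≤ κ₁ * ((1 + δ₀⁻¹) * exp (2 * ((1 : ℝ) * ((Δ : ℝ) + 1) * (2 * (Real.exp 1 * (((max (exp (v * (b + δ₀ * r ^ 2)) - 1) (2 * exp (-((κ / 2 - (κ₀ + δ₀)) * r ^ 2)))) * exp (κ * (1 + τ⁻¹) * Ψ ^ 2 / 2)) * ((1 - θ) ^ (-(κ * (1 + τ) * γ / (2 * θ)))) ^ v)))))) := by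
    refine abs_integral_div_le_of_dominated (μ := (multivariateGaussian 0 Γ)) hZ (l1y.1.const_mul κ₁) (fun ω => ?_) ?_
    · exact pointwise_A (exp_pos _) (hw'b y _)
    · rw [integral_const_mul]
      have i := mul_le_mul_of_nonneg_left l1y.2 hκ₁
      have e : (∫ ω : EuclideanSpace ℝ ι, exp (-(∑ p ∈ S, ∑ x ∈ cell p, w x (ω x + ψ₀ x))) ∂(multivariateGaussian 0 Γ)) *
            (κ₁ * ((1 + δ₀⁻¹) * exp (2 * ((1 : ℝ) * ((Δ : ℝ) + 1) * (2 * (Real.exp 1 * (((max (exp (v * (b + δ₀ * r ^ 2)) - 1) (2 * exp (-((κ / 2 - (κ₀ + δ₀)) * r ^ 2)))) * exp (κ * (1 + τ⁻¹) * Ψ ^ 2 / 2)) * ((1 - θ) ^ (-(κ * (1 + τ) * γ / (2 * θ)))) ^ v))))))) =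
          κ₁ * ((∫ ω : EuclideanSpace ℝ ι, exp (-(∑ p ∈ S, ∑ x ∈ cell p, w x (ω x + ψ₀ x))) ∂(multivariateGaussian 0 Γ)) *
            ((1 + δ₀⁻¹) * exp (2 * ((1 : ℝ) * ((Δ : ℝ) + 1) * (2 * (Real.exp 1 * (((max (exp (v * (b + δ₀ * r ^ 2)) - 1) (2 * exp (-((κ / 2 - (κ₀ + δ₀)) * r ^ 2)))) * exp (κ * (1 + τ⁻¹) * Ψ ^ 2 / 2)) * ((1 - θ) ^ (-(κ * (1 + τ) * γ / (2 * θ)))) ^ v))))))) := by ring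
      rw [e]
      exact i
  have hIB : |(∫ ω : EuclideanSpace ℝ ι, exp (-(∑ p ∈ S, ∑ x ∈ cell p, w x (ω x + ψ₀ x))) * w' z (ω z + ψ₀ z) ∂(multivariateGaussian 0 Γ))| /
      (∫ ω : EuclideanSpace ℝ ι, exp (-(∑ p ∈ S, ∑ x ∈ cell p, w x (ω x + ψ₀ x))) ∂(multivariateGaussian 0 Γ)) ≤ κ₁ * ((1 + δ₀⁻¹) * exp (2 * ((1 : ℝ) * ((Δ : ℝ) + 1) * (2 * (Real.exp 1 * (((max (exp (v * (b + δ₀ * r ^ 2)) - 1) (2 * exp (-((κ / 2 - (κ₀ + δ₀)) * r ^ 2)))) * exp (κ * (1 + τ⁻¹) * Ψ ^ 2 / 2)) * ((1 - θ) ^ (-(κ * (1 + τ) * γ / (2 * θ)))) ^ v)))))) := by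
    refine abs_integral_div_le_of_dominated (μ := (multivariateGaussian 0 Γ)) hZ (l1z.1.const_mul κ₁) (fun ω => ?_) ?_
    · exact pointwise_A (exp_pos _) (hw'b z _)
    · rw [integral_const_mul]
      have i := mul_le_mul_of_nonneg_left l1z.2 hκ₁
      have e : (∫ ω : EuclideanSpace ℝ ι, exp (-(∑ p ∈ S, ∑ x ∈ cell p, w x (ω x + ψ₀ x))) ∂(multivariateGaussian 0 Γ)) *
            (κ₁ * ((1 + δ₀⁻¹) * exp (2 * ((1 : ℝ) * ((Δ : ℝ) + 1) * (2 * (Real.exp 1 * (((max (exp (v * (b + δ₀ * r ^ 2)) - 1) (2 * exp (-((κ / 2 - (κ₀ + δ₀)) * r ^ 2)))) * exp (κ * (1 + τ⁻¹) * Ψ ^ 2 / 2)) * ((1 - θ) ^ (-(κ * (1 + τ) * γ / (2 * θ)))) ^ v))))))) =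
          κ₁ * ((∫ ω : EuclideanSpace ℝ ι, exp (-(∑ p ∈ S, ∑ x ∈ cell p, w x (ω x + ψ₀ x))) ∂(multivariateGaussian 0 Γ)) *
            ((1 + δ₀⁻¹) * exp (2 * ((1 : ℝ) * ((Δ : ℝ) + 1) * (2 * (Real.exp 1 * (((max (exp (v * (b + δ₀ * r ^ 2)) - 1) (2 * exp (-((κ / 2 - (κ₀ + δ₀)) * r ^ 2)))) * exp (κ * (1 + τ⁻¹) * Ψ ^ 2 / 2)) * ((1 - θ) ^ (-(κ * (1 + τ) * γ / (2 * θ)))) ^ v))))))) := by ring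
      rw [e]
      exact i
  -- assembly
  have n1 : 0 ≤ |(∫ ω : EuclideanSpace ℝ ι, exp (-(∑ p ∈ S, ∑ x ∈ cell p, w x (ω x + ψ₀ x))) * w' y (ω y + ψ₀ y) ∂(multivariateGaussian 0 Γ))| /
      (∫ ω : EuclideanSpace ℝ ι, exp (-(∑ p ∈ S, ∑ x ∈ cell p, w x (ω x + ψ₀ x))) ∂(multivariateGaussian 0 Γ)) := by positivity
  have n2 : 0 ≤ |(∫ ω : EuclideanSpace ℝ ι, exp (-(∑ p ∈ S, ∑ x ∈ cell p, w x (ω x + ψ₀ x))) * w' z (ω z + ψ₀ z) ∂(multivariateGaussian 0 Γ))| /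
      (∫ ω : EuclideanSpace ℝ ι, exp (-(∑ p ∈ S, ∑ x ∈ cell p, w x (ω x + ψ₀ x))) ∂(multivariateGaussian 0 Γ)) := by positivity
  have eT : |(∫ ω : EuclideanSpace ℝ ι, exp (-(∑ p ∈ S, ∑ x ∈ cell p, w x (ω x + ψ₀ x))) ∂(multivariateGaussian 0 Γ))⁻¹ *
        (∫ ω : EuclideanSpace ℝ ι, exp (-(∑ p ∈ S, ∑ x ∈ cell p, w x (ω x + ψ₀ x))) * (w'' z (ω z + ψ₀ z) * (EuclideanSpace.single y (1 : ℝ)) z - w' y (ω y + ψ₀ y) * w' z (ω z + ψ₀ z)) ∂(multivariateGaussian 0 Γ))| =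
      |(∫ ω : EuclideanSpace ℝ ι, exp (-(∑ p ∈ S, ∑ x ∈ cell p, w x (ω x + ψ₀ x))) * (w'' z (ω z + ψ₀ z) * (EuclideanSpace.single y (1 : ℝ)) z - w' y (ω y + ψ₀ y) * w' z (ω z + ψ₀ z)) ∂(multivariateGaussian 0 Γ))| /
        (∫ ω : EuclideanSpace ℝ ι, exp (-(∑ p ∈ S, ∑ x ∈ cell p, w x (ω x + ψ₀ x))) ∂(multivariateGaussian 0 Γ)) := by
    rw [abs_mul, abs_inv, abs_of_pos hZ, inv_mul_eq_div]
  have eP : |((∫ ω : EuclideanSpace ℝ ι, exp (-(∑ p ∈ S, ∑ x ∈ cell p, w x (ω x + ψ₀ x))) ∂(multivariateGaussian 0 Γ)) ^ 2)⁻¹ *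
        ((∫ ω : EuclideanSpace ℝ ι, exp (-(∑ p ∈ S, ∑ x ∈ cell p, w x (ω x + ψ₀ x))) * w' y (ω y + ψ₀ y) ∂(multivariateGaussian 0 Γ)) *
          (∫ ω : EuclideanSpace ℝ ι, exp (-(∑ p ∈ S, ∑ x ∈ cell p, w x (ω x + ψ₀ x))) * w' z (ω z + ψ₀ z) ∂(multivariateGaussian 0 Γ)))| =
      (|(∫ ω : EuclideanSpace ℝ ι, exp (-(∑ p ∈ S, ∑ x ∈ cell p, w x (ω x + ψ₀ x))) * w' y (ω y + ψ₀ y) ∂(multivariateGaussian 0 Γ))| /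
        (∫ ω : EuclideanSpace ℝ ι, exp (-(∑ p ∈ S, ∑ x ∈ cell p, w x (ω x + ψ₀ x))) ∂(multivariateGaussian 0 Γ))) *
      (|(∫ ω : EuclideanSpace ℝ ι, exp (-(∑ p ∈ S, ∑ x ∈ cell p, w x (ω x + ψ₀ x))) * w' z (ω z + ψ₀ z) ∂(multivariateGaussian 0 Γ))| /
        (∫ ω : EuclideanSpace ℝ ι, exp (-(∑ p ∈ S, ∑ x ∈ cell p, w x (ω x + ψ₀ x))) ∂(multivariateGaussian 0 Γ))) := by
    rw [abs_mul, abs_mul, abs_inv, abs_pow, abs_of_pos hZ, div_mul_div_comm, ← pow_two, inv_mul_eq_div]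
  refine (abs_add_le _ _).trans ?_
  rw [eT, eP]
  have hP := mul_le_mul hIA hIB n2 (n1.trans hIA)
  calc _ ≤ (κ₂ + κ₁ ^ 2 * (δ₀⁻¹ * exp (2 * ((1 : ℝ) * ((Δ : ℝ) + 1) * (2 * (Real.exp 1 * (((max (exp (v * (b + δ₀ * r ^ 2)) - 1) (2 * exp (-((κ / 2 - (κ₀ + δ₀)) * r ^ 2)))) * exp (κ * (1 + τ⁻¹) * Ψ ^ 2 / 2)) * ((1 - θ) ^ (-(κ * (1 + τ) * γ / (2 * θ)))) ^ v))))))) +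
        (κ₁ * ((1 + δ₀⁻¹) * exp (2 * ((1 : ℝ) * ((Δ : ℝ) + 1) * (2 * (Real.exp 1 * (((max (exp (v * (b + δ₀ * r ^ 2)) - 1) (2 * exp (-((κ / 2 - (κ₀ + δ₀)) * r ^ 2)))) * exp (κ * (1 + τ⁻¹) * Ψ ^ 2 / 2)) * ((1 - θ) ^ (-(κ * (1 + τ) * γ / (2 * θ)))) ^ v))))))) *
        (κ₁ * ((1 + δ₀⁻¹) * exp (2 * ((1 : ℝ) * ((Δ : ℝ) + 1) * (2 * (Real.exp 1 * (((max (exp (v * (b + δ₀ * r ^ 2)) - 1) (2 * exp (-((κ / 2 - (κ₀ + δ₀)) * r ^ 2)))) * exp (κ * (1 + τ⁻¹) * Ψ ^ 2 / 2)) * ((1 - θ) ^ (-(κ * (1 + τ) * γ / (2 * θ)))) ^ v))))))) := add_le_add hT hP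
    _ = _ := by ring

end Main

/-! ## §3. Toy -/

/-- Toy (§1): the unit vector's entries are at most one in absolute value. -/
example (y x : Fin 3) : |(EuclideanSpace.single y (1 : ℝ)) x| ≤ 1 := abs_single_le_one y x

end Summit.QuantumFields.BalabanUV.T4Continuum.NE7b.SupNextHessianEntryBound
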